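import Literature.Dynamics.NBody.AlbouyKaloshin2012SliceBranches
import Mathlib.Data.Complex.Basic

/-!
# Complex points of the slice branch systems: zero-dimensionality over `ℂ` suffices

Topic `Literature/Dynamics/NBody`; `pub-smale6` cell, seat 1 gen 3. The finiteness hypotheses of
`roberts_fourTypes_finite'` / `roberts_reflSymmCCs_finite` are finiteness of the REAL solution sets `t12BranchSet σ b c`,
`t1234BranchSet σ b c` of the branch systems of `AlbouyKaloshin2012SliceBranches.lean`. What a Gröbner-basis certificate
(over `ℚ`, e.g. a verified zero-dimensional basis) delivers is finiteness of the COMPLEX solution set of the same twelve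
(resp. eleven) polynomial equations. This file states the complex systems `T12BranchC`, `T1234BranchC` (the same
polynomial text, read over `ℂ`) and proves the transfer `t12BranchSet_finite_of_complex`, `t1234BranchSet_finite_of_complex`:
the real solution set embeds injectively into the complex one. (The cell's mod-`p` computations, `certs/modgb/`, are evidence
for — not a certificate of — the complex finiteness; `code/modgb/lean_crosscheck.py` checks that the computed polynomial
systems are literally these.) Elementary; no claim about any mass point is made here.
-/

namespace Literature.Dynamics.NBody

/-- A complex point of the `T12` coordinate space. [folklore] -/
structure T12PtC where
  (s t y₃ y₄ y₅ u p₃ p₄ p₅ d₃₄ d₃₅ d₄₅ : ℂ)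

/-- The branch system `T12_σ` read over `ℂ` (same polynomial text as `T12Branch`). [folklore] -/
def T12BranchC (σ₁₂ σ₃₄ σ₃₅ σ₄₅ b c : ℂ) (X : T12PtC) : Prop :=
  X.t - (b * X.p₃ ^ 3 * (X.t - X.y₃) + b * X.p₄ ^ 3 * (X.t - X.y₄) + c * X.p₅ ^ 3 * (X.t - X.y₅)) = 0 ∧
  X.s - (2 * X.u ^ 3 * X.s + b * X.p₃ ^ 3 * X.s + b * X.p₄ ^ 3 * X.s + c * X.p₅ ^ 3 * X.s) = 0 ∧
  X.y₃ - (2 * X.p₃ ^ 3 * (X.y₃ - X.t) + b * X.d₃₄ ^ 3 * (X.y₃ - X.y₄) + c * X.d₃₅ ^ 3 * (X.y₃ - X.y₅)) = 0 ∧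
  X.y₄ - (2 * X.p₄ ^ 3 * (X.y₄ - X.t) + b * X.d₃₄ ^ 3 * (X.y₄ - X.y₃) + c * X.d₄₅ ^ 3 * (X.y₄ - X.y₅)) = 0 ∧
  X.y₅ - (2 * X.p₅ ^ 3 * (X.y₅ - X.t) + b * X.d₃₅ ^ 3 * (X.y₅ - X.y₃) + b * X.d₄₅ ^ 3 * (X.y₅ - X.y₄)) = 0 ∧
  X.u * (2 * X.s) = σ₁₂ ∧
  X.p₃ ^ 2 * ((X.y₃ - X.t) ^ 2 + X.s ^ 2) - 1 = 0 ∧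
  X.p₄ ^ 2 * ((X.y₄ - X.t) ^ 2 + X.s ^ 2) - 1 = 0 ∧
  X.p₅ ^ 2 * ((X.y₅ - X.t) ^ 2 + X.s ^ 2) - 1 = 0 ∧
  X.d₃₄ * (X.y₄ - X.y₃) = σ₃₄ ∧
  X.d₃₅ * (X.y₅ - X.y₃) = σ₃₅ ∧
  X.d₄₅ * (X.y₅ - X.y₄) = σ₄₅

/-- Complex solution set of the branch system `T12_σ`. [folklore] -/
def t12BranchSetC (σ₁₂ σ₃₄ σ₃₅ σ₄₅ b c : ℂ) : Set T12PtC := {X | T12BranchC σ₁₂ σ₃₄ σ₃₅ σ₄₅ b c X}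

/-- The embedding of real points into complex points. [folklore] -/
def T12Pt.toC (X : T12Pt) : T12PtC :=
  ⟨X.s, X.t, X.y₃, X.y₄, X.y₅, X.u, X.p₃, X.p₄, X.p₅, X.d₃₄, X.d₃₅, X.d₄₅⟩

/-- The embedding is injective. [folklore] -/
theorem T12Pt.toC_injective : Function.Injective T12Pt.toC := by
  rintro ⟨_, _, _, _, _, _, _, _, _, _, _, _⟩ ⟨_, _, _, _, _, _, _, _, _, _, _, _⟩ h
  simp only [T12Pt.toC, T12PtC.mk.injEq, Complex.ofReal_inj] at h
  obtain ⟨rfl, rfl, rfl, rfl, rfl, rfl, rfl, rfl, rfl, rfl, rfl, rfl⟩ := h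
  rfl

/-- A real branch solution is a complex branch solution. [folklore] -/
theorem T12Branch.toC {σ₁₂ σ₃₄ σ₃₅ σ₄₅ b c : ℝ} {X : T12Pt} (h : T12Branch σ₁₂ σ₃₄ σ₃₅ σ₄₅ b c X) :
    T12BranchC σ₁₂ σ₃₄ σ₃₅ σ₄₅ b c X.toC := by
  obtain ⟨h1, h2, h3, h4, h5, h6, h7, h8, h9, h10, h11, h12⟩ := h
  refine ⟨?_, ?_, ?_, ?_, ?_, ?_, ?_, ?_, ?_, ?_, ?_, ?_⟩ <;> simp only [T12Pt.toC] <;>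
    first
    | exact_mod_cast h1 | exact_mod_cast h2 | exact_mod_cast h3 | exact_mod_cast h4
    | exact_mod_cast h5 | exact_mod_cast h6 | exact_mod_cast h7 | exact_mod_cast h8
    | exact_mod_cast h9 | exact_mod_cast h10 | exact_mod_cast h11 | exact_mod_cast h12

/-- **Zero-dimensionality over `ℂ` suffices (T12).** If the complex solution set of the branch system `T12_σ(b,c)` is
finite, so is the real one `t12BranchSet σ b c`. [folklore] -/
theorem t12BranchSet_finite_of_complex {σ₁₂ σ₃₄ σ₃₅ σ₄₅ b c : ℝ}
    (h : (t12BranchSetC σ₁₂ σ₃₄ σ₃₅ σ₄₅ b c).Finite) : (t12BranchSet σ₁₂ σ₃₄ σ₃₅ σ₄₅ b c).Finite := by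
  have hpre : (T12Pt.toC ⁻¹' t12BranchSetC σ₁₂ σ₃₄ σ₃₅ σ₄₅ b c).Finite :=
    h.preimage T12Pt.toC_injective.injOn
  exact hpre.subset fun X hX => T12Branch.toC hX

/-- A complex point of the `T1234` coordinate space. [folklore] -/
structure T1234PtC where
  (a₁ t₁ a₃ t₃ t₅ u v p r e f : ℂ)

/-- The branch system of `T1234` read over `ℂ` (same polynomial text as `T1234Branch`). [folklore] -/
def T1234BranchC (σ₁₂ σ₃₄ b c : ℂ) (X : T1234PtC) : Prop :=
  X.t₁ - (b * X.p ^ 3 * (X.t₁ - X.t₃) + b * X.r ^ 3 * (X.t₁ - X.t₃) + c * X.e ^ 3 * (X.t₁ - X.t₅)) = 0 ∧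
  X.a₁ - (2 * X.u ^ 3 * X.a₁ + b * X.p ^ 3 * (X.a₁ - X.a₃) + b * X.r ^ 3 * (X.a₁ + X.a₃) + c * X.e ^ 3 * X.a₁) = 0 ∧
  X.t₃ - (X.p ^ 3 * (X.t₃ - X.t₁) + X.r ^ 3 * (X.t₃ - X.t₁) + c * X.f ^ 3 * (X.t₃ - X.t₅)) = 0 ∧
  X.a₃ - (X.p ^ 3 * (X.a₃ - X.a₁) + X.r ^ 3 * (X.a₃ + X.a₁) + 2 * b * X.v ^ 3 * X.a₃ + c * X.f ^ 3 * X.a₃) = 0 ∧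
  X.t₅ - (2 * X.e ^ 3 * (X.t₅ - X.t₁) + 2 * b * X.f ^ 3 * (X.t₅ - X.t₃)) = 0 ∧
  X.u * (2 * X.a₁) = σ₁₂ ∧
  X.v * (2 * X.a₃) = σ₃₄ ∧
  X.p ^ 2 * ((X.t₃ - X.t₁) ^ 2 + (X.a₃ - X.a₁) ^ 2) - 1 = 0 ∧
  X.r ^ 2 * ((X.t₃ - X.t₁) ^ 2 + (X.a₃ + X.a₁) ^ 2) - 1 = 0 ∧
  X.e ^ 2 * ((X.t₅ - X.t₁) ^ 2 + X.a₁ ^ 2) - 1 = 0 ∧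
  X.f ^ 2 * ((X.t₅ - X.t₃) ^ 2 + X.a₃ ^ 2) - 1 = 0

/-- Complex solution set of the `T1234` branch system. [folklore] -/
def t1234BranchSetC (σ₁₂ σ₃₄ b c : ℂ) : Set T1234PtC := {X | T1234BranchC σ₁₂ σ₃₄ b c X}

/-- The embedding of real points into complex points (T1234). [folklore] -/
def T1234Pt.toC (X : T1234Pt) : T1234PtC :=
  ⟨X.a₁, X.t₁, X.a₃, X.t₃, X.t₅, X.u, X.v, X.p, X.r, X.e, X.f⟩

/-- The embedding is injective (T1234). [folklore] -/
theorem T1234Pt.toC_injective : Function.Injective T1234Pt.toC := by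
  rintro ⟨_, _, _, _, _, _, _, _, _, _, _⟩ ⟨_, _, _, _, _, _, _, _, _, _, _⟩ h
  simp only [T1234Pt.toC, T1234PtC.mk.injEq, Complex.ofReal_inj] at h
  obtain ⟨rfl, rfl, rfl, rfl, rfl, rfl, rfl, rfl, rfl, rfl, rfl⟩ := h
  rfl

/-- A real branch solution is a complex branch solution (T1234). [folklore] -/
theorem T1234Branch.toC {σ₁₂ σ₃₄ b c : ℝ} {X : T1234Pt} (h : T1234Branch σ₁₂ σ₃₄ b c X) :
    T1234BranchC σ₁₂ σ₃₄ b c X.toC := by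
  obtain ⟨h1, h2, h3, h4, h5, h6, h7, h8, h9, h10, h11⟩ := h
  refine ⟨?_, ?_, ?_, ?_, ?_, ?_, ?_, ?_, ?_, ?_, ?_⟩ <;> simp only [T1234Pt.toC] <;>
    first
    | exact_mod_cast h1 | exact_mod_cast h2 | exact_mod_cast h3 | exact_mod_cast h4
    | exact_mod_cast h5 | exact_mod_cast h6 | exact_mod_cast h7 | exact_mod_cast h8
    | exact_mod_cast h9 | exact_mod_cast h10 | exact_mod_cast h11

/-- **Zero-dimensionality over `ℂ` suffices (T1234).** [folklore] -/
theorem t1234BranchSet_finite_of_complex {σ₁₂ σ₃₄ b c : ℝ}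
    (h : (t1234BranchSetC σ₁₂ σ₃₄ b c).Finite) : (t1234BranchSet σ₁₂ σ₃₄ b c).Finite := by
  have hpre : (T1234Pt.toC ⁻¹' t1234BranchSetC σ₁₂ σ₃₄ b c).Finite :=
    h.preimage T1234Pt.toC_injective.injOn
  exact hpre.subset fun X hX => T1234Branch.toC hX

end Literature.Dynamics.NBody
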